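import Summits.QuantumFields.YangMills.Theorems.BalabanUVNodesN21RecentredDilationTransversal
import Summits.QuantumFields.YangMills.Theorems.BalabanUVNodesN21ProjectedCentreNonCollapse

/-!
# N21 (NE7c) · (M1) on the cut law about the A-PROJECTED centre: part 28's re-centred END with the non-collapse
# binder DISCHARGED by quadratic domination with obtuse cross terms (lens ROW P‴ corollary)

R134 seat pub-ymgap-dag-n21-d (g8), node N21 = NE7c (single-run shell-weight bound, NOT PRINTED in [Bałaban 1983–89],
NOT proved), lane K3⁷ `SpineGivenEndpointR13SepCoPH` (stmt-QuantumFields-20544, `--kind proof --supports … --as helper`).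
Part 34 of the comparison series; consumes part 28 (`…N21RecentredDilationTransversal`: P2
`slotAntiConcentration_restrict_of_recentredDilation`) and part 32 (`…N21ProjectedCentreNonCollapse`, lens ROW P‴:
`hmono_of_projectedCentre`).  The statement is the corollary lens v29.0 ROW P‴ names (part 33 in its numbering); this
seat types it.

WHAT THIS FILE IS.  ★ `slotAntiConcentration_restrict_of_projectedCentre`: in the product frame `X × (κ → ℝ)` with the
density `g p = 𝟙_{K p.1}(p.2)·exp(−(½⟨p.2 − m p.1, A(p.2 − m p.1)⟩ + P p.1 p.2))` — `m z` the linear Gaussian centre,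
`A` symmetric with `γ‖x‖² ≤ ⟨x, Ax⟩`, `P z` merely `G`-Lipschitz on the kept convex cut `K z` (NO convexity of the block
action) — and the dilation taken about a centre `c z ∈ K z` whose cross terms are OBTUSE at the shell ∩ cut points
(the variational inequality of the `A`-projected centre, part 32 §B) and from which the shell stays `2G∕γ`-far, part
28's `hmono` binder is DISCHARGED by part 32's `hmono_of_projectedCentre` (`l₀ = 1 − 1∕(#κ+1) ≥ 0`); the remaining
binders are the envelope, radial transversality `κ₀` and the odds `Q`, all about `c`:
`SlotAntiConcentration (ν|({U<θ} ∩ C)) U θ ρ (3(#κ+1)(1+Q)∕(κ₀(1−ρ)))`.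

HONEST FRAMING.  [textbook]; 0 def, 0 sorry; coercivity `γ`, the Lipschitz bound `G`, obtuseness, farness, envelope,
transversality and odds remain displayed HYPOTHESES; nothing of Bałaban's asserted; NE7c NOT PRINTED ∕ NOT proved; N21
NOT discharged; counts unmoved (typed 28∕28 · discharged 5∕27); count-neutral; one finite 𝕋⁴ at fixed ε — nothing
about ℝ⁴ ∕ OS ∕ mass gap ∕ Clay.
-/

open MeasureTheory Set Function Matrix
open scoped ENNReal

namespace Summit.QuantumFields.YangMills.Theorems.N21ProjectedCentreDilation

open Literature.MathematicalPhysics.QuantumFieldTheory.Balaban1983to89.T4ShellMeasure (SlotAntiConcentration)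
open Summit.QuantumFields.YangMills.Theorems.N21RecentredDilationTransversal
  (slotAntiConcentration_restrict_of_recentredDilation)
open Summit.QuantumFields.YangMills.Theorems.N21ProjectedCentreNonCollapse (hmono_of_projectedCentre)

variable {X : Type*} [MeasurableSpace X] {κ : Type*} [Fintype κ]

/-- ★ **(M1) ON THE CUT LAW ABOUT THE A-PROJECTED CENTRE** (lens v29.0 ROW P‴ corollary): part 28's P2 with the
density `𝟙_{K p.1}(p.2)·exp(−(½⟨p.2 − m p.1, A(p.2 − m p.1)⟩ + P p.1 p.2))`, the dilation about the centre `c`, and the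
non-collapse binder discharged by quadratic domination with obtuse cross terms (part 32 `hmono_of_projectedCentre`).
[textbook] -/
theorem slotAntiConcentration_restrict_of_projectedCentre [Nonempty κ] (ζ : Measure X) [SFinite ζ]
    (K : X → Set (κ → ℝ)) (A : Matrix κ κ ℝ) (hA : A.IsSymm) {γ G : ℝ} (hγ0 : 0 < γ)
    (hγ : ∀ x : κ → ℝ, γ * ‖x‖ ^ 2 ≤ x ⬝ᵥ (A *ᵥ x))
    (m : X → (κ → ℝ)) {c : X → (κ → ℝ)} (hc : Measurable c) (P : X → (κ → ℝ) → ℝ)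
    (hg : Measurable fun p : X × (κ → ℝ) => (K p.1).indicator (fun w => ENNReal.ofReal (Real.exp
      (-(1 / 2 * ((w - m p.1) ⬝ᵥ (A *ᵥ (w - m p.1))) + P p.1 w)))) p.2)
    {U : X × (κ → ℝ) → ℝ} (hUm : Measurable U)
    {C Env : Set (X × (κ → ℝ))} (hC : MeasurableSet C) (hEnv : MeasurableSet Env)
    {θ ρ κ₀ Q : ℝ} (hθ : 0 < θ) (hρ0 : 0 < ρ) (hρ1 : ρ < 1) (hκ : 0 < κ₀) (hQ0 : 0 ≤ Q)
    (hK : ∀ z, Convex ℝ (K z)) (hcK : ∀ z, c z ∈ K z)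
    (hP : ∀ z, ∀ v ∈ K z, ∀ v' ∈ K z, P z v - P z v' ≤ G * ‖v - v'‖)
    (hobt : ∀ p : X × (κ → ℝ), θ * (1 - ρ) ≤ U p → U p < θ → p ∈ C → p.2 ∈ K p.1 →
      0 ≤ (c p.1 - m p.1) ⬝ᵥ (A *ᵥ (p.2 - c p.1)))
    (hfar : ∀ p : X × (κ → ℝ), θ * (1 - ρ) ≤ U p → U p < θ → p ∈ C → p.2 ∈ K p.1 →
      2 * G ≤ γ * ‖p.2 - c p.1‖)
    (henv : ∀ l ∈ Icc (1 - 1 / ((Fintype.card κ : ℝ) + 1)) 1, ∀ p : X × (κ → ℝ),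
      θ * (1 - ρ) ≤ U p → U p < θ → p ∈ C → (p.1, c p.1 + l • (p.2 - c p.1)) ∈ Env)
    (hRT : ∀ p : X × (κ → ℝ), θ * (1 - ρ) ≤ U p → U p < θ → p ∈ C → ∀ s : ℝ, 1 ≤ s →
      θ * (1 - ρ) ≤ U (p.1, c p.1 + s • (p.2 - c p.1)) → U (p.1, c p.1 + s • (p.2 - c p.1)) < θ →
        (p.1, c p.1 + s • (p.2 - c p.1)) ∈ C →
          U p + κ₀ * (θ * (1 - ρ)) * (s - 1) ≤ U (p.1, c p.1 + s • (p.2 - c p.1)))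
    (hQ : ((ζ.prod volume).withDensity fun p : X × (κ → ℝ) => (K p.1).indicator (fun w => ENNReal.ofReal (Real.exp
        (-(1 / 2 * ((w - m p.1) ⬝ᵥ (A *ᵥ (w - m p.1))) + P p.1 w)))) p.2) (Env \ ({p | U p < θ} ∩ C))
      ≤ ENNReal.ofReal Q * ((ζ.prod volume).withDensity fun p : X × (κ → ℝ) => (K p.1).indicator (fun w =>
        ENNReal.ofReal (Real.exp (-(1 / 2 * ((w - m p.1) ⬝ᵥ (A *ᵥ (w - m p.1))) + P p.1 w)))) p.2)
        ({p | U p < θ} ∩ C)) :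
    SlotAntiConcentration
      ((((ζ.prod volume).withDensity fun p : X × (κ → ℝ) => (K p.1).indicator (fun w => ENNReal.ofReal (Real.exp
          (-(1 / 2 * ((w - m p.1) ⬝ᵥ (A *ᵥ (w - m p.1))) + P p.1 w)))) p.2)).restrict ({p | U p < θ} ∩ C))
      U θ ρ (3 * ((Fintype.card κ : ℝ) + 1) * (1 + Q) / (κ₀ * (1 - ρ))) := by
  have hl₀ : 0 ≤ 1 - 1 / ((Fintype.card κ : ℝ) + 1) := by
    rw [sub_nonneg, div_le_one (by positivity)]
    linarith [show (0 : ℝ) ≤ Fintype.card κ from Nat.cast_nonneg _]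
  exact slotAntiConcentration_restrict_of_recentredDilation ζ hc hg hUm hC hEnv hθ hρ0 hρ1 hκ hQ0 henv
    (hmono_of_projectedCentre K A hA hγ0 hγ m c P U C hl₀ hK hcK hP hobt hfar) hRT hQ

end Summit.QuantumFields.YangMills.Theorems.N21ProjectedCentreDilation
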